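import Mathlib

/-!
# Route `JensenPolynomials`, FAR crux `XiWindowZeroFreeRelFar` (B1-rel) — contour tools V: existence and location of a zero
of a holomorphic function near an approximate zero (the complex saddle) (RH-FREE; cell rh-jensen, HUMAN RULING D-0040)

The far-Gumbel line for item `stmt-RiemannHypothesis-19465` (stub `stub_laplaceFar`) evaluates the kernel integral by the
Laplace method along the horizontal line THROUGH THE EXACT SADDLE `u_s` of the far phase `Ψ` (`Ψ′(u_s) = 0`; only at an
exact critical point does the window bound `JensenPolynomialsLaplaceWindow` apply without drift). The saddle is not a closed
form; it is produced from the closed-form leading saddle `u⁽⁰⁾ = υ + ¼Log w` by a fixed-point argument. This file proves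
the generic brick (simplified Newton–Kantorovich in `ℂ`, via Banach's fixed-point theorem on a closed disc):

* `exists_zero_near_of_hasDerivAt`: if `g` has derivative `g′` on the closed disc `D̄(z₀, ρ)` with `‖g′(z) − d‖ ≤ q‖d‖`
  there (`d ≠ 0`, `0 ≤ q < 1`) and `‖g(z₀)‖ ≤ (1 − q)ρ‖d‖`, then `g` has a zero `z⋆ ∈ D̄(z₀, ρ)` with the a-priori bound
  `‖z⋆ − z₀‖ ≤ ‖g(z₀)‖/((1 − q)‖d‖)`;
* `zero_unique_of_hasDerivAt`: under the same derivative hypothesis the zero in the disc is unique.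

WHAT THIS IS NOT: textbook analysis (Kantorovich 1948; Banach 1922); nothing here bears on the zeros of `ζ` or the truth of RH.
-/

noncomputable section
-- D-0017: `Summit.RiemannHypothesis.RiemannHypothesis.…` duplicates the namespace BY DESIGN (single-problem summit).
set_option linter.dupNamespace false

namespace Summit.RiemannHypothesis.RiemannHypothesis.Theorems.JensenPolynomials.WindowEGF

open Set Metric Filter
open scoped Topology NNReal

/-- The contraction estimate behind Newton's method with frozen derivative: if `‖g′ − d‖ ≤ q‖d‖` on a convex set `s`, then
`T z = z − g(z)/d` satisfies `‖T z − T w‖ ≤ q‖z − w‖` on `s`. -/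
theorem norm_newtonStep_sub_le {g g' : ℂ → ℂ} {s : Set ℂ} (hs : Convex ℝ s) {d : ℂ} (hd : d ≠ 0) {q : ℝ}
    (hg : ∀ z ∈ s, HasDerivAt g (g' z) z) (hlip : ∀ z ∈ s, ‖g' z - d‖ ≤ q * ‖d‖) {z w : ℂ} (hz : z ∈ s) (hw : w ∈ s) :
    ‖(z - g z / d) - (w - g w / d)‖ ≤ q * ‖z - w‖ := by
  -- `h u = g u − d u` has derivative `g′ u − d`, of norm `≤ q‖d‖`
  have hh : ∀ u ∈ s, HasDerivWithinAt (fun u => g u - d * u) (g' u - d) s u := by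
    intro u hu
    have h0 := ((hg u hu).sub ((hasDerivAt_id u).const_mul d))
    exact ((h0.congr_deriv (by simp)).congr_of_eventuallyEq
      (Filter.Eventually.of_forall fun y => rfl)).hasDerivWithinAt
  have hmv := hs.norm_image_sub_le_of_norm_hasDerivWithin_le hh (fun u hu => hlip u hu) hw hz
  -- `T z − T w = −(h z − h w)/d`
  have hdn : 0 < ‖d‖ := norm_pos_iff.mpr hd
  have e : (z - g z / d) - (w - g w / d) = -(((g z - d * z) - (g w - d * w)) / d) := by
    field_simp
    ring
  rw [e, norm_neg, norm_div, div_le_iff₀ hdn]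
  calc ‖(g z - d * z) - (g w - d * w)‖ ≤ q * ‖d‖ * ‖z - w‖ := hmv
    _ = q * ‖z - w‖ * ‖d‖ := by ring

/-- **A zero near an approximate zero (simplified Newton–Kantorovich in `ℂ`).** Let `g` have derivative `g′` at every
point of the closed disc `D̄(z₀, ρ)`, with `‖g′(z) − d‖ ≤ q·‖d‖` there for some `d ≠ 0` and `0 ≤ q < 1`, and let
`‖g(z₀)‖ ≤ (1 − q)·ρ·‖d‖`. Then there is `z⋆` with `‖z⋆ − z₀‖ ≤ ρ`, `g(z⋆) = 0`, and moreover
`‖z⋆ − z₀‖ ≤ ‖g(z₀)‖ / ((1 − q)‖d‖)`. -/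
theorem exists_zero_near_of_hasDerivAt {g g' : ℂ → ℂ} {z₀ d : ℂ} {ρ q : ℝ} (hρ : 0 ≤ ρ) (hd : d ≠ 0)
    (hq0 : 0 ≤ q) (hq1 : q < 1)
    (hg : ∀ z ∈ closedBall z₀ ρ, HasDerivAt g (g' z) z)
    (hlip : ∀ z ∈ closedBall z₀ ρ, ‖g' z - d‖ ≤ q * ‖d‖)
    (hsmall : ‖g z₀‖ ≤ (1 - q) * ρ * ‖d‖) :
    ∃ z : ℂ, ‖z - z₀‖ ≤ ρ ∧ g z = 0 ∧ ‖z - z₀‖ ≤ ‖g z₀‖ / ((1 - q) * ‖d‖) := by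
  have hdn : 0 < ‖d‖ := norm_pos_iff.mpr hd
  set T : ℂ → ℂ := fun z => z - g z / d with hT
  have hconv : Convex ℝ (closedBall z₀ ρ) := convex_closedBall z₀ ρ
  have hcontr : ∀ z ∈ closedBall z₀ ρ, ∀ w ∈ closedBall z₀ ρ, ‖T z - T w‖ ≤ q * ‖z - w‖ :=
    fun z hz w hw => norm_newtonStep_sub_le hconv hd hg hlip hz hw
  have hT0 : ‖T z₀ - z₀‖ = ‖g z₀‖ / ‖d‖ := by
    simp only [hT, sub_sub_cancel_left, norm_neg, norm_div]
  -- `T` maps the disc into itself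
  have hmaps : MapsTo T (closedBall z₀ ρ) (closedBall z₀ ρ) := by
    intro z hz
    rw [mem_closedBall, dist_eq_norm] at hz ⊢
    have h1 := hcontr z (by rwa [mem_closedBall, dist_eq_norm]) z₀ (mem_closedBall_self hρ)
    have h2 : ‖g z₀‖ / ‖d‖ ≤ (1 - q) * ρ := by
      rw [div_le_iff₀ hdn]; exact hsmall
    calc ‖T z - z₀‖ = ‖(T z - T z₀) + (T z₀ - z₀)‖ := by congr 1; ring
      _ ≤ ‖T z - T z₀‖ + ‖T z₀ - z₀‖ := norm_add_le _ _
      _ ≤ q * ‖z - z₀‖ + ‖g z₀‖ / ‖d‖ := add_le_add h1 hT0.le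
      _ ≤ q * ρ + (1 - q) * ρ := add_le_add (mul_le_mul_of_nonneg_left hz hq0) h2
      _ = ρ := by ring
  -- Banach's fixed point theorem on the complete set `closedBall z₀ ρ`
  have hK : ContractingWith ⟨q, hq0⟩ (hmaps.restrict T (closedBall z₀ ρ) (closedBall z₀ ρ)) := by
    refine ⟨by exact_mod_cast hq1, LipschitzWith.of_dist_le_mul fun z w => ?_⟩
    simp only [Subtype.dist_eq, MapsTo.val_restrict_apply, dist_eq_norm]
    exact hcontr z.1 z.2 w.1 w.2
  obtain ⟨zs, hzs, hfix, -⟩ := ContractingWith.exists_fixedPoint' (isClosed_closedBall.isComplete) hmaps hK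
    (mem_closedBall_self hρ) (edist_ne_top _ _)
  have hzs' : ‖zs - z₀‖ ≤ ρ := by rwa [mem_closedBall, dist_eq_norm] at hzs
  have hgz : g zs = 0 := by
    have h : T zs = zs := hfix
    simp only [hT] at h
    have : g zs / d = 0 := by linear_combination (-1 : ℂ) * h
    rcases div_eq_zero_iff.mp this with h' | h'
    · exact h'
    · exact absurd h' hd
  refine ⟨zs, hzs', hgz, ?_⟩
  -- a-priori bound from `zs − z₀ = (T zs − T z₀) + (T z₀ − z₀)`
  have h1 := hcontr zs hzs z₀ (mem_closedBall_self hρ)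
  have h3 : ‖zs - z₀‖ ≤ q * ‖zs - z₀‖ + ‖g z₀‖ / ‖d‖ := by
    calc ‖zs - z₀‖ = ‖(T zs - T z₀) + (T z₀ - z₀)‖ := by rw [hfix]; congr 1; ring
      _ ≤ ‖T zs - T z₀‖ + ‖T z₀ - z₀‖ := norm_add_le _ _
      _ ≤ q * ‖zs - z₀‖ + ‖g z₀‖ / ‖d‖ := add_le_add h1 hT0.le
  have h1q : 0 < 1 - q := by linarith
  rw [le_div_iff₀ (mul_pos h1q hdn)]
  have h4 : (1 - q) * ‖zs - z₀‖ ≤ ‖g z₀‖ / ‖d‖ := by nlinarith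
  calc ‖zs - z₀‖ * ((1 - q) * ‖d‖) = ((1 - q) * ‖zs - z₀‖) * ‖d‖ := by ring
    _ ≤ (‖g z₀‖ / ‖d‖) * ‖d‖ := mul_le_mul_of_nonneg_right h4 hdn.le
    _ = ‖g z₀‖ := div_mul_cancel₀ _ hdn.ne'

/-- **Uniqueness of the zero in the disc.** Under the derivative hypothesis `‖g′ − d‖ ≤ q‖d‖` (`q < 1`) on the closed disc,
two zeros of `g` in the disc coincide. -/
theorem zero_unique_of_hasDerivAt {g g' : ℂ → ℂ} {z₀ d : ℂ} {ρ q : ℝ} (hd : d ≠ 0) (hq1 : q < 1)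
    (hg : ∀ z ∈ closedBall z₀ ρ, HasDerivAt g (g' z) z)
    (hlip : ∀ z ∈ closedBall z₀ ρ, ‖g' z - d‖ ≤ q * ‖d‖)
    {z w : ℂ} (hz : z ∈ closedBall z₀ ρ) (hw : w ∈ closedBall z₀ ρ) (hgz : g z = 0) (hgw : g w = 0) : z = w := by
  have h := norm_newtonStep_sub_le (convex_closedBall z₀ ρ) hd hg hlip hz hw
  rw [hgz, hgw, zero_div, sub_zero, sub_zero] at h
  by_contra hne
  have hpos : 0 < ‖z - w‖ := norm_pos_iff.mpr (sub_ne_zero.mpr hne)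
  nlinarith

end Summit.RiemannHypothesis.RiemannHypothesis.Theorems.JensenPolynomials.WindowEGF

end
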